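import Literature.Analysis.FluidPDE.CheskidovDaiBootstrap
import Literature.Analysis.FluidPDE.LerayHopfBoundedWindowRegular
import HarnessLib

/-!
# Cheskidov–Dai's level-occupation regularity criterion, house form: the discharge

Analysis/FluidPDE **proofs file** (theorems only: no definitions, no named facts, no `sorry`):
the named fact `Literature.Analysis.FluidPDE.cheskidov_dai_occupation`
(`CheskidovDaiOccupationCriterion.lean`; Cheskidov–Dai, arXiv:1507.06611 = Proc. Edinburgh Math.
Soc. (2025), §1 Thm. 1.1, Navier–Stokes case, in the house rendering of the tree's continuation
criteria: a classical solution on `ℝ³ × [0,T)`, Leray–Hopf from its rapidly decaying datum, whose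
level occupation of the dissipation range on `(T/2, T)` is at most `c`, extends as a classical
solution past `T`) is PROVED, by composing the printed `H¹` form
`cheskidov_dai_occupation_regular_holds` (`CheskidovDaiBootstrap.lean`) with the bridges of
`LerayHopfBoundedWindowRegular.lean` (`cheskidov_dai_occupation_of_regular`: classical Leray–Hopf
solutions are `H¹`-regular below the final time; `H¹`-regularity at `T` gives the smooth
extension).

## References

* A. Cheskidov, M. Dai, arXiv:1507.06611 = Proc. Edinburgh Math. Soc. (2025), §1 Thm. 1.1.
  [CheskidovDai2015]
-/

noncomputable section

namespace Literature.Analysis.FluidPDE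

/-- **Cheskidov–Dai 2015, Thm. 1.1 (NSE), house form, proved**: the named fact
`cheskidov_dai_occupation` holds (`cheskidov_dai_occupation_of_regular` applied to
`cheskidov_dai_occupation_regular_holds`). [cite: CheskidovDai2015, §1 Thm. 1.1 (case b ≡ 0, r = ∞)] -/
theorem cheskidov_dai_occupation_holds : cheskidov_dai_occupation :=
  cheskidov_dai_occupation_of_regular cheskidov_dai_occupation_regular_holds

end Literature.Analysis.FluidPDE

end
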